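import Summits.Ventures.HodgeRepro2.T6B1Incoherent

/-!
# T6B1Main — the top theorem of Tier-6 sub-goal B1 (proof lane)

`B1_main`: for a number field `K` (= F⁺), a non-square `θ ∈ K` negative at every real place (so `E = K(√θ)` is the CM
field F), and a real place `τ` of `K`, there is a totally positive definite INCOHERENT hermitian space `𝕍` over `A_E` of
rank `3` (Liu Def. C.3) together with a hermitian space `W` over `E` which is `τ`-nearby to `𝕍` (Liu Def. C.4), of
signature `(2, 1)` at `τ` and positive definite — signature `(3, 0)` — at every other real place: TIER4 B1 (B1.b) and
(B1.d), derived from the three displayed published statements `Hyp.OMeara1963_65_15`, `Hyp.OMeara1963_71_18`,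
`Hyp.OMeara1963_71_19` and nothing else. `B1_compactCase` and `B1_dimension` are the arithmetic of (B1.e).
The carriers and the cited predicates are those of `T6B1Carriers`; the construction is `T6B1Construct` + `T6B1Incoherent`.
-/

namespace Summit.Ventures.HodgeRepro2.T6
namespace B1Main

open NumberField IsDedekindDomain Matrix B1Carriers B1Local B1Construct B1Incoherent
open scoped ComplexOrder

variable (K : Type*) [Field K] [NumberField K]

/-- **B1, (B1.b) + (B1.d) in kernel.** Let `K` be a number field, `θ ∈ K` a non-square which is negative at every real
place of `K` (Liu's / O'Meara's datum: `F = K` totally real in the application, `E = K(√θ)` a CM field), and `τ` a real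
place of `K`. Assuming the three displayed theorems of O'Meara (65:15, 71:18, 71:19 + 71:19a), there exist
* a hermitian space `𝕍` over `A_E` of rank `3`, totally positive definite and incoherent (Liu Def. C.3), and
* a hermitian space `W` over `E` of rank `3` which is `τ`-nearby to `𝕍` (Liu Def. C.4), positive definite at every real
  place `w ≠ τ` and of signature `(2, 1)` at `τ`. -/
theorem B1_main (θ : K) (hθ : ¬ IsSquare θ) (hneg : ∀ (w : InfinitePlace K) (hw : w.IsReal), realOf K hw θ < 0)
    {τ : InfinitePlace K} (hτ : τ.IsReal)
    (h1 : Hyp.OMeara1963_65_15 K) (h2 : Hyp.OMeara1963_71_18 K) (h3 : Hyp.OMeara1963_71_19 K) :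
    ∃ 𝕍 : AdelicHermitianSpace K θ 3, IsTotallyPositiveDefinite K 𝕍 ∧ IsIncoherentSpace K 𝕍 ∧
      ∃ W : GlobalHermitianSpace K θ 3, IsNearbyAt K hτ 𝕍 W ∧
        (∀ (w : InfinitePlace K) (hw : w.IsReal), w ≠ τ → (globalGramAt K W hw).PosDef) ∧
        HasSig (globalGramAt K W hτ) 2 1 := by
  classical
  obtain ⟨v₀, hv₀⟩ := exists_fin_not_isSquare K h1 hθ
  obtain ⟨α, hα, hfin, hinf⟩ := exists_alpha K h3 v₀ hv₀ hτ (hneg τ hτ)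
  have hsymτ : hilbertInf K τ α θ = -1 := by rw [hinf τ, if_pos rfl]
  have hsym : ∀ (w : InfinitePlace K), w ≠ τ → hilbertInf K w α θ = 1 := fun w hw => by
    rw [hinf w, if_neg hw]
  have hpos : ∀ (w : InfinitePlace K) (hw : w.IsReal), w ≠ τ → 0 < realOf K hw α := fun w hw hne => by
    have := hsym w hne
    rw [hilbertInf_eq_real K hw, hilbertSymbol_real_eq_one_iff (hneg w hw)] at this
    exact this
  refine ⟨V K θ τ hα, isTotallyPositiveDefinite_V K θ τ hα hpos,
    isIncoherentSpace_V K h2 (ne_zero_of_not_isSquare K hθ) τ hα v₀ hfin hinf,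
    W K θ hα, isNearbyAt_V_W K θ hτ (hneg τ hτ) hα hsymτ, fun w hw hne => ?_,
    hasSig_W_of_symbol_neg_one K θ hα hτ (hneg τ hτ) hsymτ⟩
  exact posDef_W_of_symbol_one K θ hα hw (hneg w hw) (hsym w hne)

omit [NumberField K] in
/-- **(B1.e), the Compact Case.** Liu's Noncompact Case requires `d = 1` (p. 45 l. 48); for `d ≠ 1` — in the route
`d = [F⁺:ℚ] = 3` — we are in the Compact Case, whatever `n` and the isotropy clause are. -/
theorem B1_compactCase {d n : ℕ} (hd : d ≠ 1) (isotropicAtEveryPrime : Prop) :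
    IsCompactCase d n isotropicAtEveryPrime :=
  fun h => hd h.1

/-- **(B1.e), the dimension count.** With signature `(2, 1)` at `τ` and `(3, 0)` at every other real place, Liu's
dimension `Σ_{τ ∈ Φ_F} p_τ q_τ` (p. 108 ll. 30–33) equals `2 = n − 1`. -/
theorem B1_dimension (sig : InfinitePlace K → ℕ × ℕ) (τ : InfinitePlace K) (hτ : sig τ = (2, 1))
    (hother : ∀ w, w ≠ τ → sig w = (3, 0)) :
    ∑ w : InfinitePlace K, (sig w).1 * (sig w).2 = 2 := by
  rw [Finset.sum_eq_single τ]
  · rw [hτ]; rfl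
  · intro w _ hw
    rw [hother w hw]; rfl
  · intro h
    exact absurd (Finset.mem_univ τ) h

end B1Main
end Summit.Ventures.HodgeRepro2.T6
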